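import Summits.BirchSwinnertonDyer.BirchSwinnertonDyer.Theorems.ByReductionTypeAtTwoFineSelmerConjAAtTwoAdditivePotGoodCubicDiscriminant
import Literature.NumberTheory.IwasawaTheory.CyclotomicTwoTotallyRamifiedOddIndex
import Literature.NumberTheory.IwasawaTheory.Fukuda1994Thm1Proofs
import HarnessLib

/-!
# Route `ByReductionTypeAtTwo` (rung K4), crux C1″ `FineSelmerConjAAtTwoAdditivePotGood` (item stmt-BirchSwinnertonDyer-22615):
# THE TWO-LAYER DOOR — `μ₂(F^cyc) = 0` for a cubic field `F` with ODD discriminant from the class-number parities of `F` and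
# of the first layer `F₁ = F(√2)` ONLY, Fukuda's index `n₀ = 0` being DISCHARGED BY THE KERNEL
# (a `--supports 22615` file; seat `bsd-2adic-k4-w1` GEN 5; sequel of `…UniquePrimeDoor` / `…CensusDoorStamps*`)

HONEST FRAMING (cell `bsd-2adic`, D-0036/D-0054/D-0152): types-the-object-of; closes nothing at the `∀`-level; nothing booked; BSD
is not proved by any of this. Inputs displayed BY NAME: `hLim2` = Lim 2017 Thm. 3.5 + Lemma 3.2 at `p = 2` (per-curve doors only).
Fukuda 1994 Thm. 1 (1) is NOT an input: it is the tree's DISCHARGED fact `fukuda1994_thm1_classNumberPExp_const_of_succ_eq_holds`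
(kernel); neither is Fukuda's standing hypothesis «every ramified prime of `F_∞/F` is totally ramified» (`TotallyRamifiedFrom κ 0`):
it is PROVED here for every cubic (indeed odd-degree) field of odd discriminant by the parity criterion of
`Literature/NumberTheory/IwasawaTheory/CyclotomicTwoTotallyRamifiedOddIndex.lean` (this seat, p687770; `√2 ∈ F₁` forces even
`e(Q|2)` above, odd `e(w|2)` below ⟹ every `w ∣ 2` ramifies in `F₁` ⟹ `n₀ = 0`, `…ZpExtensionTotallyRamifiedFromLayerOne`, p687257).

WHY (pen RC-341 (b) / RC-350 / RC-353 (4); GEN 4 HANDOFF «OPEN (2): the 30 C1″-RES rows are conjecture-grade»). After GEN 4 the additive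
`t = 0` census of K4 reads 14 DOOR rows (one prime above `2` ∧ odd `h`: Iwasawa 1956, kernel) + 30 `C1″-RES` rows
(`fineSelmerConjAAtTwoAdditivePotGoodResidual`: two primes above `2` or even `h`). For a field with SEVERAL primes above `2` the one
classical lever is Fukuda's two-layer criterion (`e_0 = e_1 ⟹ e_n` constant), which k4-w2's `…T0ConjADischarge*` rows display as an
ABSTRACT certificate `hcert : ∀ κL cyclotomic, TotallyRamifiedFrom κL n₀ ∧ rank₂ Cl(F_{n+1}) = rank₂ Cl(F_n)` about the tower. This file
turns it, for the fields in which `2` is UNRAMIFIED (odd discriminant: splitting types `𝔭₁𝔭₂`, `𝔭₁𝔭₂𝔭₃`, inert), into a door with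
the ramification conjunct GONE and the remaining data CONCRETE:

* §1 FIELD DOORS (unconditional): `classNumberPExp_eq_zero_of_odd_discr_of_layerOne` — for a number field `F` with `2 ∤ [F:ℚ]` and
  `2 ∤ d_F`, a cyclotomic `ℤ₂`-extension `κ`, `2 ∤ #Cl(𝓞 F)` and `e_1(κ) = 0`: `e_n(κ) = 0` for EVERY `n` (`A_n = 0` all along the
  tower); `classicalMuVanishes_two_of_odd_discr_of_layerOne` — hence `μ₂ = 0` (growth form); the same from the finer hypothesis
  «every `w ∣ 2` has odd `e(w|2)`» (`…_of_oddRamification_…`, covering `2 = 𝔭³` too).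
* §2 `classNumberPExp_one_eq_zero_iff` — the displayed bit `e_1(κ) = 0` IS the parity `2 ∤ #Cl(𝓞 F₁)` of the class number of the
  first layer `F₁ = κ.layer 1`, a quadratic extension of `F` containing `√2` (`exists_sq_eq_two_layer_one_of_not_dvd_finrank`,
  p687770), i.e. of `F(√2)` — decidable data (PARI `bnfinit(F(√2)).cyc`, column `cyc6` of the cell's census TSV
  `addL2x/gen5/conjA2_census_j289938_classes.tsv`; `bnfcertify` for an unconditional value).
* §3 PER-CURVE DOOR (mod `hLim2` only) `fineSelmerDual_moduleFinite_two_of_odd_discr_pointField`: for ANY elliptic `W/ℚ` and non-zero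
  `P ∈ W[2]` whose point field `ℚ(P)` has odd degree, odd discriminant, odd class number and `e_1 = 0` along its cyclotomic
  `ℤ₂`-extensions, statement (A)₂(W) holds (`∃ γ D` currency of C1″).
* §4 CUBIC CURRENCY: `odd_discr_adjoin_of_odd_cubic_discr` (`2 ∤ disc(X³+pX²+qX+r)` ⟹ `2 ∤ d_{ℚ(β)}`, by GEN 4's index formula
  `disc = m²·d_K`), `classicalMuVanishes_two_adjoin_of_odd_cubic_discr`, and the model door
  `fineSelmerDual_moduleFinite_two_cubicModel_of_odd_discr` for `y² = x³ + px² + qx + r` — the shape consumed by per-row stamps.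

CENSUS EFFECT (addL2x GEN 5 TSV, columns `dec2inF3/cyc3/cyc6/ramK6`): the `𝔭₁𝔭₂` rows `293200be1` (`d = 733`, `Cl(F) = Cl(F₁) = []`)
and `412992bw1` (`d = 6453`, idem) leave `C1″-RES` for the door side at the grade «`hLim2` + TWO parity bits» (stamps: sequel file);
the `𝔭₁𝔭₂`/`𝔭₁𝔭₂𝔭₃` rows with `2 ∣ h(F₁)` (`230660a1`, `412400n1`, `174920h1`) are exactly the ones this door cannot reach (Fukuda needs
`e_1 = e_0`). The 19 `𝔭²𝔮` rows need the even-index certificate (sequel). So the residual conjecture of C1″ SHRINKS to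
«`μ₂ = 0` for the `S₃`-cubics with (`2 ∣ h`) ∨ (`2 ∣ h(F(√2))`) ∨ (a prime above `2` of even index unramified in `F(√2)`)».

References: [Fukuda1994] Thm. 1 (1), p. 264; [Washington1997] §13.1, Prop. 13.2, Lemma 13.3; [Lim2017FineSelmer] Thm. 3.5, Lemma 3.2;
[CoatesSujatha2005] (A); [Marcus1977] Ch. 2 Ex. 27 (index formula); [NeukirchANT1999] III (2.12).
-/

set_option autoImplicit false
-- sibling precedent (`…CubicDiscriminant.lean`): the directory name repeats the summit name
set_option linter.dupNamespace false

noncomputable section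

open scoped Classical IntermediateField NumberField

namespace Summit.BirchSwinnertonDyer.BirchSwinnertonDyer.Theorems.AddKatoTwo

open WeierstrassCurve Field Polynomial IsDedekindDomain NumberField Literature.NumberTheory.EllipticCurves
  Literature.NumberTheory.GaloisRepresentations
  Literature.NumberTheory.IwasawaTheory
  Summit.BirchSwinnertonDyer.BirchSwinnertonDyer.Theorems.AlignedTransportAtTwoTorsionPointField
  Summit.BirchSwinnertonDyer.BirchSwinnertonDyer.Theses.ByReductionTypeAtTwo

/-! ## §1 THE FIELD DOORS (unconditional): `e_0 = e_1 = 0` and odd ramification above `2` ⟹ `e_n = 0` for all `n` -/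

section FieldDoor

variable (F : Type) [Field F] [NumberField F]

/-- `e_0(κ) = 0` from `2 ∤ #Cl(𝓞 F)`: the bottom layer `F_0 = ⊥ ≃ F` has the class number of `F`. [folklore]
[cite: Washington1997, §13.1] -/
theorem classNumberPExp_zero_eq_zero_of_odd_classNumber (hh : ¬ 2 ∣ Nat.card (ClassGroup (𝓞 F)))
    (κ : ZpExtension F 2) : classNumberPExp κ 0 = 0 := by
  haveI : FiniteDimensional F (κ.layer 0) := κ.finiteDimensional_layer_holds 0
  haveI : NumberField (κ.layer 0) := NumberField.of_module_finite F (κ.layer 0)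
  rw [classNumberPExp_eq_padicValNat_classNumber]
  refine padicValNat.eq_zero_of_not_dvd fun h => hh ?_
  have e : (κ.layer 0) ≃ₐ[F] F :=
    (IntermediateField.equivOfEq κ.layer_zero).trans (IntermediateField.botEquiv F _)
  have hcl : classNumber (κ.layer 0) = classNumber F :=
    Fintype.card_congr (ClassGroup.mulEquiv (RingOfIntegers.mapRingEquiv e.toRingEquiv)).toEquiv
  rwa [hcl, NumberField.classNumber, ← Nat.card_eq_fintype_card] at h

/-- **THE TWO-LAYER FIELD DOOR (ramification form), UNCONDITIONAL.** For a number field `F` with `2 ∤ [F:ℚ]` in which EVERY prime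
above `2` has ODD ramification index, a cyclotomic `ℤ₂`-extension `κ` of `F`, `2 ∤ #Cl(𝓞 F)` (`e_0 = 0`) and `e_1(κ) = 0`
(`2 ∤ h(F₁)`, `F₁ = F(√2)` the first layer): `e_n(κ) = ord₂ #Cl(𝓞 F_n) = 0` for EVERY `n`. Fukuda 1994 Thm. 1 (1) with `n₀ = 0`
(tree, DISCHARGED: `fukuda1994_thm1_classNumberPExp_const_of_succ_eq_holds`), his standing hypothesis `TotallyRamifiedFrom κ 0` being
the kernel theorem `totallyRamifiedFrom_zero_of_forall_odd_ramificationIdx`. [cite: Fukuda1994, Thm. 1 (1), p. 264]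
[cite: Washington1997, §13.1 Lemma 13.3] -/
theorem classNumberPExp_eq_zero_of_oddRamification_of_layerOne (hF : ¬ 2 ∣ Module.finrank ℚ F)
    (hodd : ∀ w : HeightOneSpectrum (𝓞 F), ((2 : ℕ) : 𝓞 F) ∈ w.asIdeal → Odd (w.asIdeal.ramificationIdx ℤ))
    (κ : ZpExtension F 2) (hκ : κ.IsCyclotomic) (hh : ¬ 2 ∣ Nat.card (ClassGroup (𝓞 F)))
    (h1 : classNumberPExp κ 1 = 0) (n : ℕ) : classNumberPExp κ n = 0 :=
  classNumberPExp_eq_zero_of_succ_eq_zero fukuda1994_thm1_classNumberPExp_const_of_succ_eq_holds κ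
    (totallyRamifiedFrom_zero_of_forall_odd_ramificationIdx hF κ hκ hodd) le_rfl
    (classNumberPExp_zero_eq_zero_of_odd_classNumber F hh κ) h1 (Nat.zero_le n)

/-- **THE TWO-LAYER FIELD DOOR (discriminant form), UNCONDITIONAL.** For a number field `F` of ODD degree and ODD discriminant
(`2` unramified in `F`), a cyclotomic `ℤ₂`-extension `κ`, `2 ∤ #Cl(𝓞 F)` and `e_1(κ) = 0`: `e_n(κ) = 0` for every `n`.
[cite: Fukuda1994, Thm. 1 (1), p. 264] [cite: NeukirchANT1999, Ch. III (2.12)] -/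
theorem classNumberPExp_eq_zero_of_odd_discr_of_layerOne (hF : ¬ 2 ∣ Module.finrank ℚ F)
    (hd : ¬ (2 : ℤ) ∣ NumberField.discr F) (κ : ZpExtension F 2) (hκ : κ.IsCyclotomic)
    (hh : ¬ 2 ∣ Nat.card (ClassGroup (𝓞 F))) (h1 : classNumberPExp κ 1 = 0) (n : ℕ) : classNumberPExp κ n = 0 :=
  classNumberPExp_eq_zero_of_succ_eq_zero fukuda1994_thm1_classNumberPExp_const_of_succ_eq_holds κ
    (totallyRamifiedFrom_zero_of_not_dvd_discr hF hd κ hκ) le_rfl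
    (classNumberPExp_zero_eq_zero_of_odd_classNumber F hh κ) h1 (Nat.zero_le n)

/-- **`μ₂ = 0` (growth form, indeed `λ = ν = 0`) by the two-layer door, ramification form.** UNCONDITIONAL.
[cite: Fukuda1994, Thm. 1 (1), p. 264] [cite: Washington1997, §13.1 Lemma 13.3] -/
theorem classicalMuVanishes_two_of_oddRamification_of_layerOne (hF : ¬ 2 ∣ Module.finrank ℚ F)
    (hodd : ∀ w : HeightOneSpectrum (𝓞 F), ((2 : ℕ) : 𝓞 F) ∈ w.asIdeal → Odd (w.asIdeal.ramificationIdx ℤ))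
    (κ : ZpExtension F 2) (hκ : κ.IsCyclotomic) (hh : ¬ 2 ∣ Nat.card (ClassGroup (𝓞 F)))
    (h1 : classNumberPExp κ 1 = 0) : ClassicalMuVanishes κ :=
  classicalMuVanishes_of_eventually_const κ (c := 0) (n₀ := 0)
    fun n _ => classNumberPExp_eq_zero_of_oddRamification_of_layerOne F hF hodd κ hκ hh h1 n

/-- **`μ₂ = 0` (growth form) by the two-layer door, discriminant form.** UNCONDITIONAL: for `F` of odd degree and odd discriminant,
`2 ∤ h(F)` and `2 ∤ h(F₁)` give `μ₂(F^cyc) = 0`. [cite: Fukuda1994, Thm. 1 (1), p. 264] [cite: NeukirchANT1999, Ch. III (2.12)] -/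
theorem classicalMuVanishes_two_of_odd_discr_of_layerOne (hF : ¬ 2 ∣ Module.finrank ℚ F)
    (hd : ¬ (2 : ℤ) ∣ NumberField.discr F) (κ : ZpExtension F 2) (hκ : κ.IsCyclotomic)
    (hh : ¬ 2 ∣ Nat.card (ClassGroup (𝓞 F))) (h1 : classNumberPExp κ 1 = 0) : ClassicalMuVanishes κ :=
  classicalMuVanishes_of_eventually_const κ (c := 0) (n₀ := 0)
    fun n _ => classNumberPExp_eq_zero_of_odd_discr_of_layerOne F hF hd κ hκ hh h1 n

end FieldDoor

/-! ## §2 The displayed bit `e_1 = 0` is the class-number parity of the first layer `F₁ ∋ √2` -/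

section LayerOne

variable (F : Type) [Field F] [NumberField F]

/-- **`e_1(κ) = 0 ⟺ 2 ∤ #Cl(𝓞 F₁)`**, `F₁ = κ.layer 1` the first layer (a number field, quadratic over `F`). [folklore]
[cite: Washington1997, §13.1] -/
theorem classNumberPExp_one_eq_zero_iff (κ : ZpExtension F 2) :
    haveI : FiniteDimensional F (κ.layer 1) := κ.finiteDimensional_layer_holds 1
    haveI : NumberField (κ.layer 1) := NumberField.of_module_finite F (κ.layer 1)
    classNumberPExp κ 1 = 0 ↔ ¬ 2 ∣ Nat.card (ClassGroup (𝓞 (κ.layer 1))) := by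
  haveI : FiniteDimensional F (κ.layer 1) := κ.finiteDimensional_layer_holds 1
  haveI : NumberField (κ.layer 1) := NumberField.of_module_finite F (κ.layer 1)
  rw [classNumberPExp_eq_padicValNat_classNumber, padicValNat.eq_zero_iff, NumberField.classNumber,
    ← Nat.card_eq_fintype_card]
  have h0 : Nat.card (ClassGroup (𝓞 (κ.layer 1))) ≠ 0 := Nat.card_pos.ne'
  constructor
  · rintro (h | h | h)
    · exact absurd h (by norm_num)
    · exact absurd h h0
    · exact h
  · exact fun h => Or.inr (Or.inr h)

/-- **The first layer is `F(√2)`**: for `2 ∤ [F:ℚ]` and `κ` cyclotomic, `F₁ = κ.layer 1` has degree `2` over `F` and contains an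
element of square `2` (`exists_sq_eq_two_layer_one_of_not_dvd_finrank`, `finrank_layer_holds`) — so the bit of §1 is the parity of
`h(F(√2))` (PARI: `bnfinit(polcompositum(f, x^2-2))`). [cite: Washington1997, §13.1] -/
theorem finrank_layer_one_and_exists_sq_eq_two (hF : ¬ 2 ∣ Module.finrank ℚ F) (κ : ZpExtension F 2)
    (hκ : κ.IsCyclotomic) : Module.finrank F (κ.layer 1) = 2 ∧ ∃ θ : κ.layer 1, θ ^ 2 = 2 :=
  ⟨by rw [κ.finrank_layer_holds 1, pow_one], exists_sq_eq_two_layer_one_of_not_dvd_finrank hF κ hκ⟩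

end LayerOne

/-! ## §3 THE PER-CURVE DOOR (mod `hLim2` only) -/

section CurveDoor

/-- **THE TWO-LAYER DOOR, per curve** (granted Lim 2017 Thm. 3.5 at `2` BY NAME, `hLim2`; Fukuda and the ramification conjunct are
kernel): for ANY elliptic `W/ℚ` and ANY non-zero `P ∈ W[2]`, if the point field `ℚ(P) = ℚ̄^{Stab(P)}` has ODD degree, ODD
discriminant, ODD class number, and `e_1 = 0` (odd class number of its quadratic layer `ℚ(P)(√2)`) along its cyclotomic
`ℤ₂`-extensions, then statement (A)₂(W) holds (`∃ γ D` currency of C1″). No scope hypothesis of C1″ is used.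
CONDITIONAL on `hLim2` and the two displayed parity data. [cite: Lim2017FineSelmer, §3 Thm. 3.5 and Lemma 3.2]
[cite: Fukuda1994, Thm. 1 (1), p. 264] [cite: CoatesSujatha2005, §3 statement (A)] -/
theorem fineSelmerDual_moduleFinite_two_of_odd_discr_pointField
    (hLim2 : Lim2017.thm35_at_two_fineSelmerDual_moduleFinite_of_classicalMuVanishes_of_le_divisionField_four)
    (W : WeierstrassCurve ℚ) [W.IsElliptic] {P : geomTorsion W 2} (hP : P ≠ 0)
    (hF : haveI := finiteDimensional_fixedField_stabilizer W P
      ¬ 2 ∣ Module.finrank ℚ (IntermediateField.fixedField (MulAction.stabilizer (absoluteGaloisGroup ℚ) P)))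
    (hd : haveI := finiteDimensional_fixedField_stabilizer W P
      haveI : NumberField (IntermediateField.fixedField (MulAction.stabilizer (absoluteGaloisGroup ℚ) P)) := NumberField.mk
      ¬ (2 : ℤ) ∣ NumberField.discr (IntermediateField.fixedField (MulAction.stabilizer (absoluteGaloisGroup ℚ) P)))
    (hh : ¬ 2 ∣ Nat.card (ClassGroup (𝓞 (IntermediateField.fixedField (MulAction.stabilizer (absoluteGaloisGroup ℚ) P)))))
    (h1 : haveI := finiteDimensional_fixedField_stabilizer W P
      haveI : NumberField (IntermediateField.fixedField (MulAction.stabilizer (absoluteGaloisGroup ℚ) P)) := NumberField.mk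
      ∀ κL : ZpExtension (IntermediateField.fixedField (MulAction.stabilizer (absoluteGaloisGroup ℚ) P)) 2,
        κL.IsCyclotomic → classNumberPExp κL 1 = 0)
    (κ : ZpExtension ℚ 2) (hκ : κ.IsCyclotomic) :
    ∃ (γ : absoluteGaloisGroup ℚ) (D : W.FineSelmerDualData κ γ),
      Module.Finite ℤ_[2] (RestrictScalars ℤ_[2] (IwasawaAlgebra 2) D.X) := by
  haveI := finiteDimensional_fixedField_stabilizer W P
  haveI : NumberField (IntermediateField.fixedField (MulAction.stabilizer (absoluteGaloisGroup ℚ) P)) := NumberField.mk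
  exact fineSelmerDual_moduleFinite_two_of_classicalMu_pointField hLim2 W hP
    (fun κL hκL ↦ classicalMuVanishes_two_of_odd_discr_of_layerOne _ hF hd κL hκL hh (h1 κL hκL)) κ hκ

end CurveDoor

/-! ## §4 THE CUBIC CURRENCY: odd cubic discriminant -/

section CubicCurrency

variable {p q r : ℤ}

/-- **`2 ∤ disc(X³ + pX² + qX + r)` ⟹ `2 ∤ d_{ℚ(β)}`** for a root `β ∈ ℚ̄` of the irreducible integer cubic: `disc = m²·d_K` (GEN 4's index
formula `exists_sq_mul_discr_eq`). KERNEL. [cite: Marcus1977, Ch. 2 Exercise 27] -/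
theorem odd_discr_adjoin_of_odd_cubic_discr (hirr : Irreducible (Cubic.toPoly ⟨1, (p : ℚ), q, r⟩))
    (hdisc : ¬ (2 : ℤ) ∣ Cubic.discr ⟨1, p, q, r⟩) {β : AlgebraicClosure ℚ}
    (hβ : aeval β (Cubic.toPoly ⟨1, (p : ℚ), q, r⟩) = 0) :
    haveI : FiniteDimensional ℚ (IntermediateField.adjoin ℚ {β}) :=
      IntermediateField.adjoin.finiteDimensional ((AlgebraicClosure.isAlgebraic ℚ).isAlgebraic β).isIntegral
    haveI : NumberField (IntermediateField.adjoin ℚ {β}) := NumberField.mk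
    ¬ (2 : ℤ) ∣ NumberField.discr (IntermediateField.adjoin ℚ {β}) := by
  haveI : FiniteDimensional ℚ (IntermediateField.adjoin ℚ {β}) :=
    IntermediateField.adjoin.finiteDimensional ((AlgebraicClosure.isAlgebraic ℚ).isAlgebraic β).isIntegral
  haveI : NumberField (IntermediateField.adjoin ℚ {β}) := NumberField.mk
  obtain ⟨b, -, hb⟩ := exists_ringOfIntegers_cubic_root (p := p) (q := q) (r := r) hβ
  obtain ⟨m, -, hmd⟩ := exists_sq_mul_discr_eq _ (finrank_adjoin_eq_three_of_irreducible hirr hβ) b hirr hb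
  intro h2
  exact hdisc (hmd ▸ Dvd.dvd.mul_left h2 (m ^ 2))

/-- `[ℚ(β) : ℚ] = 3` is odd. [folklore] -/
private theorem not_two_dvd_finrank_adjoin (hirr : Irreducible (Cubic.toPoly ⟨1, (p : ℚ), q, r⟩))
    {β : AlgebraicClosure ℚ} (hβ : aeval β (Cubic.toPoly ⟨1, (p : ℚ), q, r⟩) = 0) :
    ¬ 2 ∣ Module.finrank ℚ (IntermediateField.adjoin ℚ {β}) := by
  rw [finrank_adjoin_eq_three_of_irreducible hirr hβ]; norm_num

/-- **THE TWO-LAYER DOOR in the cubic currency, UNCONDITIONAL**: for an irreducible `X³ + pX² + qX + r ∈ ℤ[X]` with ODD discriminant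
and a root `β ∈ ℚ̄`, if `2 ∤ #Cl(𝓞 ℚ(β))` and `e_1 = 0` (i.e. `2 ∤ h(ℚ(β, √2))`, §2) along the cyclotomic `ℤ₂`-extension `κ` of `ℚ(β)`,
then Iwasawa's `μ₂` of `ℚ(β)` vanishes (growth form; indeed `e_n = 0` for all `n`). The complement, inside the odd-discriminant
`S₃`-cubics, of the residual conjecture of C1″. [cite: Fukuda1994, Thm. 1 (1), p. 264] [cite: NeukirchANT1999, Ch. III (2.12)] -/
theorem classicalMuVanishes_two_adjoin_of_odd_cubic_discr (hirr : Irreducible (Cubic.toPoly ⟨1, (p : ℚ), q, r⟩))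
    (hdisc : ¬ (2 : ℤ) ∣ Cubic.discr ⟨1, p, q, r⟩) {β : AlgebraicClosure ℚ}
    (hβ : aeval β (Cubic.toPoly ⟨1, (p : ℚ), q, r⟩) = 0)
    (hh : ¬ 2 ∣ Nat.card (ClassGroup (𝓞 (IntermediateField.adjoin ℚ {β}))))
    (κ : ZpExtension (IntermediateField.adjoin ℚ {β}) 2) (hκ : κ.IsCyclotomic) (h1 : classNumberPExp κ 1 = 0) :
    ClassicalMuVanishes κ := by
  haveI : FiniteDimensional ℚ (IntermediateField.adjoin ℚ {β}) :=
    IntermediateField.adjoin.finiteDimensional ((AlgebraicClosure.isAlgebraic ℚ).isAlgebraic β).isIntegral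
  haveI : NumberField (IntermediateField.adjoin ℚ {β}) := NumberField.mk
  exact classicalMuVanishes_two_of_odd_discr_of_layerOne _ (not_two_dvd_finrank_adjoin hirr hβ)
    (odd_discr_adjoin_of_odd_cubic_discr hirr hdisc hβ) κ hκ hh h1

/-- The same with the conclusion `e_n = 0` for every layer (`A_n = 0` all along the tower). [cite: Fukuda1994, Thm. 1 (1), p. 264] -/
theorem classNumberPExp_eq_zero_adjoin_of_odd_cubic_discr (hirr : Irreducible (Cubic.toPoly ⟨1, (p : ℚ), q, r⟩))
    (hdisc : ¬ (2 : ℤ) ∣ Cubic.discr ⟨1, p, q, r⟩) {β : AlgebraicClosure ℚ}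
    (hβ : aeval β (Cubic.toPoly ⟨1, (p : ℚ), q, r⟩) = 0)
    (hh : ¬ 2 ∣ Nat.card (ClassGroup (𝓞 (IntermediateField.adjoin ℚ {β}))))
    (κ : ZpExtension (IntermediateField.adjoin ℚ {β}) 2) (hκ : κ.IsCyclotomic) (h1 : classNumberPExp κ 1 = 0) (n : ℕ) :
    classNumberPExp κ n = 0 := by
  haveI : FiniteDimensional ℚ (IntermediateField.adjoin ℚ {β}) :=
    IntermediateField.adjoin.finiteDimensional ((AlgebraicClosure.isAlgebraic ℚ).isAlgebraic β).isIntegral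
  haveI : NumberField (IntermediateField.adjoin ℚ {β}) := NumberField.mk
  exact classNumberPExp_eq_zero_of_odd_discr_of_layerOne _ (not_two_dvd_finrank_adjoin hirr hβ)
    (odd_discr_adjoin_of_odd_cubic_discr hirr hdisc hβ) κ hκ hh h1 n

/-- **(A)₂ from TWO parity bits, per curve, odd-discriminant point field.** Granted `hLim2`: for any elliptic `W/ℚ` and non-zero
`P ∈ W[2]` whose point field is `ℚ(β)` for a root `β` of an irreducible integer cubic `X³ + pX² + qX + r` of ODD discriminant,
`2 ∤ #Cl(𝓞 ℚ(β))` and `e_1 = 0` along the cyclotomic `ℤ₂`-extensions of `ℚ(β)` ⟹ statement (A)₂(W).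
[cite: Lim2017FineSelmer, §3 Thm. 3.5 and Lemma 3.2] [cite: Fukuda1994, Thm. 1 (1), p. 264] [cite: CoatesSujatha2005, §3 statement (A)] -/
theorem fineSelmerDual_moduleFinite_two_of_odd_cubic_discr_pointField
    (hLim2 : Lim2017.thm35_at_two_fineSelmerDual_moduleFinite_of_classicalMuVanishes_of_le_divisionField_four)
    (W : WeierstrassCurve ℚ) [W.IsElliptic] {P : geomTorsion W 2} (hP : P ≠ 0)
    (hirr : Irreducible (Cubic.toPoly ⟨1, (p : ℚ), q, r⟩)) (hdisc : ¬ (2 : ℤ) ∣ Cubic.discr ⟨1, p, q, r⟩)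
    {β : AlgebraicClosure ℚ} (hβ : aeval β (Cubic.toPoly ⟨1, (p : ℚ), q, r⟩) = 0)
    (hFβ : IntermediateField.fixedField (MulAction.stabilizer (absoluteGaloisGroup ℚ) P) = IntermediateField.adjoin ℚ {β})
    (hh : ¬ 2 ∣ Nat.card (ClassGroup (𝓞 (IntermediateField.adjoin ℚ {β}))))
    (h1 : haveI : FiniteDimensional ℚ (IntermediateField.adjoin ℚ {β}) :=
        IntermediateField.adjoin.finiteDimensional ((AlgebraicClosure.isAlgebraic ℚ).isAlgebraic β).isIntegral
      haveI : NumberField (IntermediateField.adjoin ℚ {β}) := NumberField.mk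
      ∀ κL : ZpExtension (IntermediateField.adjoin ℚ {β}) 2, κL.IsCyclotomic → classNumberPExp κL 1 = 0)
    (κ : ZpExtension ℚ 2) (hκ : κ.IsCyclotomic) :
    ∃ (γ : absoluteGaloisGroup ℚ) (D : W.FineSelmerDualData κ γ),
      Module.Finite ℤ_[2] (RestrictScalars ℤ_[2] (IwasawaAlgebra 2) D.X) := by
  have hμP : ∀ κL : ZpExtension (IntermediateField.fixedField (MulAction.stabilizer (absoluteGaloisGroup ℚ) P)) 2,
      κL.IsCyclotomic → ClassicalMuVanishes κL := by
    rw [hFβ]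
    exact fun κL hκL ↦ classicalMuVanishes_two_adjoin_of_odd_cubic_discr hirr hdisc hβ hh κL hκL (h1 κL hκL)
  exact fineSelmerDual_moduleFinite_two_of_classicalMu_pointField hLim2 W hP hμP κ hκ

/-- **The cubic model**: for `W : y² = x³ + px² + qx + r` over `ℚ` (`p q r : ℤ`, irreducible cubic of ODD discriminant, `W` elliptic)
and a root `β`, the `2`-torsion point `(β, 0)` has point field `ℚ(β)` (`…CubicRealization`); so `2 ∤ #Cl(𝓞 ℚ(β))` and `e_1 = 0` along the
cyclotomic `ℤ₂`-extensions of `ℚ(β)` ⟹ (A)₂(W), granted `hLim2`. The shape consumed by the census stamps.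
[cite: Lim2017FineSelmer, §3 Thm. 3.5 and Lemma 3.2] [cite: Fukuda1994, Thm. 1 (1), p. 264] -/
theorem fineSelmerDual_moduleFinite_two_cubicModel_of_odd_discr
    (hLim2 : Lim2017.thm35_at_two_fineSelmerDual_moduleFinite_of_classicalMuVanishes_of_le_divisionField_four)
    (hirr : Irreducible (Cubic.toPoly ⟨1, (p : ℚ), q, r⟩)) (hdisc : ¬ (2 : ℤ) ∣ Cubic.discr ⟨1, p, q, r⟩)
    [(⟨0, (p : ℚ), 0, q, r⟩ : WeierstrassCurve ℚ).IsElliptic]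
    {β : AlgebraicClosure ℚ} (hβ : aeval β (Cubic.toPoly ⟨1, (p : ℚ), q, r⟩) = 0)
    (hh : ¬ 2 ∣ Nat.card (ClassGroup (𝓞 (IntermediateField.adjoin ℚ {β}))))
    (h1 : haveI : FiniteDimensional ℚ (IntermediateField.adjoin ℚ {β}) :=
        IntermediateField.adjoin.finiteDimensional ((AlgebraicClosure.isAlgebraic ℚ).isAlgebraic β).isIntegral
      haveI : NumberField (IntermediateField.adjoin ℚ {β}) := NumberField.mk
      ∀ κL : ZpExtension (IntermediateField.adjoin ℚ {β}) 2, κL.IsCyclotomic → classNumberPExp κL 1 = 0)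
    (κ : ZpExtension ℚ 2) (hκ : κ.IsCyclotomic) :
    ∃ (γ : absoluteGaloisGroup ℚ) (D : (⟨0, (p : ℚ), 0, q, r⟩ : WeierstrassCurve ℚ).FineSelmerDualData κ γ),
      Module.Finite ℤ_[2] (RestrictScalars ℤ_[2] (IwasawaAlgebra 2) D.X) := by
  obtain ⟨P₀, hP₀, hP₀eq⟩ := exists_geomTorsion_two_eq_some_root (p : ℚ) q r hβ
  exact fineSelmerDual_moduleFinite_two_of_odd_cubic_discr_pointField hLim2 _ hP₀ hirr hdisc hβ
    (fixedField_stabilizer_eq_adjoin_root (p : ℚ) q r hβ hP₀eq) hh h1 κ hκ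

end CubicCurrency

end Summit.BirchSwinnertonDyer.BirchSwinnertonDyer.Theorems.AddKatoTwo

end
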